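import Summits.Ventures.PercRepro.SixFourPLListMem
import Summits.Ventures.PercRepro.SixFourPLCov3A

/-!
# PercRepro — C-025 at `(6,4)`: the DATA SIDE of the `g ∈ {8, 9}` plane-line piece of `SixFourResidue` (p2, gen 8 — TYPING DRAFT, part 1)

mine-2's `MINE2-RLS.md` §21.18.9 (the (γ) plane-line branch of Theorem 22″ at `g = 8, 9`, in p3's vocabulary): a
plane-line solid `G` with every plane trace `≤ g − 3` points has a normalisation `D : PLData M G` whose coarse profile
lies in the cap-parametrised list `LISTK g (g − 3)` (22.12.5 with the cap `K = g − 3` — §21.18.9.1), and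
Theorem 22.12 holds with the refined covering bound `X̄′` (Lemma X̄′, §21.18.9.2 — `PL.Xbar'` of
`SixFourPLCov3A`) in place of `X̄`: `15·Jlow′(π(G)) ≤ 15·J₄(G)`.  On `LISTK 9 6` (109 rows) `15·Jlow′ > 0`
everywhere; on `LISTK 8 5` (23 rows) everywhere except the single row `π₀`, whose solids form ONE structure `S₀`
with `15·J₄ ≥ 918` (§21.18.9.3).  Hence `0 ≤ J₄(G)` for every plane-line solid with `8 ≤ g ≤ 9` and planes
`≤ g − 3` — the (γ) half of the clause `typeOf M G = 4 → G.card ≤ 9 → 0 ≤ J M G 4` of `SixFourResidue`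
(`SixFourTransfer.lean`); the (α) generic and (β) «plane + ≤ 2 points» halves and `g ≤ 7` are p3's trichotomy.

This file is a TYPING DRAFT for p3 (lead (lh)(2), INBOX 2717): the data side (`J15'`, `ConstraintsK`, `LISTK`,
`pi0`) is computable and its finite checks are kernel facts; the matroid-side statements reproduce the §21.18.9 cut
as hypotheses (`hpl : ∀ P ∈ planes M, (P ∩ G).card + 3 ≤ G.card`, `8 ≤ G.card ≤ 9`, `D : PLData M G`) and are
left `sorry` where their proofs are the `K`-forms of p3's / mine-2's step files (named in each docstring).
-/

namespace PercRepro.SixFour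

namespace PL

/-! ## The data side of §21.18.9: `15·Jlow′`, the cap-parametrised constraints and list -/

/-- `15·Jlow′(π) = 3·5F − 3·5cost + 3·5bonus + 10·lpp − 18·X̄′` (§21.18.9.2; `J15` with `Xbar'` for `Xbar`). -/
def J15' (π : CProf) : ℤ :=
  3 * F5 (g π) - 3 * cost5sum π + 3 * bonus5sum π + 10 * lpp π - 18 * Xbar' π

/-- `X̄′ ≤ X̄`: the third term of `Xbar` is `covOld`, and `Xbar'` takes `min (covOld, covNew)`. -/
theorem Xbar'_le_Xbar (π : CProf) : Xbar' π ≤ Xbar π := by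
  unfold Xbar' Xbar
  gcongr
  exact Nat.min_le_left (covOld π) (covNew π)

/-- `15·Jlow ≤ 15·Jlow′`. -/
theorem J15_le_J15' (π : CProf) : J15 π ≤ J15' π := by
  unfold J15 J15'
  have h : (Xbar' π : ℤ) ≤ Xbar π := by exact_mod_cast Xbar'_le_Xbar π
  linarith

/-- **The constraints of 22.12.5 with the cap as a parameter (§21.18.9.1)**: `4 ≤ p ≤ K`, `inc_m = 0` for
`m ≥ p`, the pair identity, `3 ≤ n`, `n + e ≤ K − 1`, `p + n = g`, class sizes non-increasing, `≥ 1` (skew) /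
`≥ 2` (meeting), `≤ K − n`, with the skew / meeting sum rules and `#{j : s_j = m} ≤ inc_m` — NO pairwise-line
constraints.  (`Constraints` of `SixFourPLListMem.lean` is the slice `K = 7`, `10 ≤ g ≤ 13`.) -/
def ConstraintsK (g K : ℕ) (π : CProf) : Prop :=
  4 ≤ π.p ∧ π.p ≤ K ∧ 3 ≤ π.n ∧ π.n + e π ≤ K - 1 ∧ π.p + π.n = g ∧
  π.inc.length = 6 ∧ (∀ i, i < 6 → π.p ≤ i + 2 → π.inc.getD i 0 = 0) ∧
  ((List.range 6).map fun i => ch (i + 2) 2 * π.inc.getD i 0).sum = ch π.p 2 ∧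
  π.sizes.Pairwise (· ≥ ·) ∧ (∀ s ∈ π.sizes, s ≤ K - π.n) ∧
  (if π.meet then (∀ s ∈ π.sizes, 2 ≤ s) ∧ (π.sizes.map fun s => s - 1).sum = π.p - 1
    else (∀ s ∈ π.sizes, 1 ≤ s) ∧ π.sizes.sum = π.p) ∧
  (∀ m, 2 ≤ m → m ≤ 7 → π.sizes.count m ≤ π.inc.getD (m - 2) 0)

/-- **The list `LIST(g, K)` of §21.18.9.1**: the enumeration of `LIST` (22.12.5) with `4 ≤ p ≤ K`, `n = g − p ≥ 3`,
`n + e ≤ K − 1` and class sizes `≤ K − n` (the width-`6` line vector suffices for `g ≤ 11`, §21.18.9.1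
clarification 2 (a)).  `LISTK 10 7` is the `g = 10` block of `LIST`. -/
def LISTK (g K : ℕ) : List CProf :=
  (List.range (K - 3)).flatMap fun pi =>
    let p := pi + 4
    (vecs p).flatMap fun vec =>
      match incFromVec p vec with
      | none => []
      | some inc =>
        [false, true].flatMap fun meet =>
          let n := g - p
          let ee := if meet then 1 else 0
          if 3 ≤ n ∧ p + n = g ∧ n + ee ≤ K - 1 then
            let ss := if meet then parts2 p (p - 1) (K - n) else parts p p (K - n)
            (ss.filter fun sizes => (List.range 6).all fun i => sizes.count (i + 2) ≤ inc.getD i 0).map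
              fun sizes => ⟨meet, p, n, inc, sizes⟩
          else []

/-- `π₀ = (meet, p = 5, n = 3, inc = (4, 0, 1, 0, 0, 0), sizes = (2, 2, 2, 2))` — the one `g = 8` row with
`15·Jlow′ ≤ 0` (§21.18.9.3). -/
def pi0 : CProf := ⟨true, 5, 3, [4, 0, 1, 0, 0, 0], [2, 2, 2, 2]⟩

set_option Elab.async false

/-- `LIST(8, 5)` has `23` rows (§21.18.9.0). -/
theorem LISTK_8_5_length : (LISTK 8 5).length = 23 := by decide +kernel

/-- `LIST(9, 6)` has `109` rows (§21.18.9.0). -/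
theorem LISTK_9_6_length : (LISTK 9 6).length = 109 := by decide +kernel

/-- `LIST(10, 7)` has `388` rows — the `g = 10` block of `LIST` (22.12.5), the cross-check of the enumerator. -/
theorem LISTK_10_7_length : (LISTK 10 7).length = 388 := by decide +kernel

/-- `π₀ ∈ LIST(8, 5)`. -/
theorem pi0_mem_LISTK : pi0 ∈ LISTK 8 5 := by decide +kernel

/-- `15·Jlow′(π₀) = −486` (§21.18.9.3: `5F = 650`, `5cost = 264`, `5bonus = 20`, `lpp = 60`, `X̄′ = 128`). -/
theorem J15'_pi0 : J15' pi0 = -486 := by decide +kernel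

/-- **The finite check at `g = 9`**: `0 < 15·Jlow′(π)` on every row of `LIST(9, 6)` (minimum `260`). -/
theorem LISTK_9_6_pos : (LISTK 9 6).all (fun π => decide (0 < J15' π)) = true := by decide +kernel

/-- **The finite check at `g = 8`**: every row of `LIST(8, 5)` is `π₀` or has `0 < 15·Jlow′`. -/
theorem LISTK_8_5_pos : (LISTK 8 5).all (fun π => decide (π = pi0 ∨ 0 < J15' π)) = true := by decide +kernel

/-- `0 < 15·Jlow′(π)` for every `π ∈ LIST(9, 6)`. -/
theorem J15'_pos_of_mem_9 {π : CProf} (h : π ∈ LISTK 9 6) : 0 < J15' π := by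
  have := LISTK_9_6_pos
  rw [List.all_eq_true] at this
  simpa using this π h

/-- `0 < 15·Jlow′(π)` for every `π ∈ LIST(8, 5)` other than `π₀`. -/
theorem J15'_pos_of_mem_8 {π : CProf} (h : π ∈ LISTK 8 5) (hne : π ≠ pi0) : 0 < J15' π := by
  have := LISTK_8_5_pos
  rw [List.all_eq_true] at this
  have h' := this π h
  simp only [decide_eq_true_eq] at h'
  exact h'.resolve_left hne

/-- **Completeness of `LISTK` (the `K`-form of `mem_LIST_of_constraints`)**: every coarse profile satisfying
`ConstraintsK g K` is in `LISTK g K`.  Proof = `SixFourPLListMem.lean` with `7 → K`, `10 ≤ g ≤ 13 → g`. -/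
theorem mem_LISTK_of_constraintsK {g K : ℕ} (hK : K ≤ 7) {π : CProf} (h : ConstraintsK g K π) :
    π ∈ LISTK g K := by
  obtain ⟨hp4, hpK, hn3, hne, hg, hlen, hzero, hsum, hsort, hcap, hcase, hcount⟩ := h
  unfold LISTK
  simp only [List.mem_flatMap, List.mem_range]
  refine ⟨π.p - 4, by omega, ?_⟩
  rw [show π.p - 4 + 4 = π.p by omega]
  refine ⟨(π.inc.drop 1).take (π.p - 3), ?_, ?_⟩
  · -- the line-size vector is produced by `vecs`
    unfold vecs
    apply mem_vecsAux
    · rw [List.length_take, List.length_drop, hlen]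
      omega
    · intro i hi
      rw [List.length_take, List.length_drop, hlen] at hi
      have hi' : i < π.p - 3 := lt_of_lt_of_le hi (min_le_left _ _)
      rw [getD_take_drop _ _ _ hi']
      have hterm := term_le_of_sum hsum (show i + 1 < 6 by omega)
      rw [show i + 1 + 2 = 3 + i by omega] at hterm
      rw [Nat.le_div_iff_mul_le (ch_two_pos (by omega))]
      rw [Nat.mul_comm]
      exact hterm
  · rw [incFromVec_eq hp4 (by omega) hlen hzero hsum]
    simp only [List.mem_flatMap, List.mem_cons, List.not_mem_nil, or_false]
    refine ⟨π.meet, by cases π.meet <;> simp, ?_⟩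
    have hgp : g - π.p = π.n := by omega
    rw [hgp]
    have hcond : 3 ≤ π.n ∧ π.p + π.n = g ∧ π.n + (if π.meet then 1 else 0) ≤ K - 1 := by
      refine ⟨hn3, hg, ?_⟩
      unfold e at hne
      exact hne
    rw [if_pos hcond]
    simp only [List.mem_map, List.mem_filter, List.all_eq_true, List.mem_range, decide_eq_true_eq]
    refine ⟨π.sizes, ⟨?_, fun i hi => hcount (i + 2) (by omega) (by omega)⟩, rfl⟩
    cases hm : π.meet
    · -- skew
      rw [hm] at hcase
      simp only [Bool.false_eq_true, if_false] at hcase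
      simp only [Bool.false_eq_true, if_false]
      apply mem_parts π.sizes π.p π.p (K - π.n) hsort hcase.1 hcap hcase.2
      rw [← hcase.2]
      exact List.length_le_sum_of_one_le _ hcase.1
    · -- meeting
      rw [hm] at hcase
      simp only [if_true] at hcase
      simp only [if_true]
      apply mem_parts2 π.sizes π.p (π.p - 1) (K - π.n) hsort hcase.1 hcap hcase.2
      calc π.sizes.length = (π.sizes.map fun s => s - 1).length := (List.length_map _).symm
        _ ≤ (π.sizes.map fun s => s - 1).sum := by
          apply List.length_le_sum_of_one_le
          intro t ht
          rw [List.mem_map] at ht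
          obtain ⟨s, hs, rfl⟩ := ht
          have := hcase.1 s hs
          omega
        _ = π.p - 1 := hcase.2
        _ ≤ π.p := Nat.sub_le _ _

end PL

end PercRepro.SixFour
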